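import Literature.NumberTheory.LFunctions.RiemannXiLogDeriv
import Literature.NumberTheory.LFunctions.ZetaArgVariation
import Mathlib.Analysis.Complex.Convex
import Mathlib.Analysis.Analytic.IsolatedZeros
import Mathlib.Analysis.SpecialFunctions.Pow.Deriv

/-!
# `SignCone.ConeMagnification`, line `Sketch` (r3): the torus inequality for EVENTUALLY-`Λ` weights, I —
# from the Carathéodory majorant to `Re P(1/2 + it) ≤ 1/2` on the critical line
(crux stmt-RiemannHypothesis-16303; HELPER file, `--supports`; registered sub-goal
`re_dirichletPoly_critical_le_half` of the special case `torusOfCara_of_eventually_vonMangoldt` of the open core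
`stub_torusOfCara`)

The open core `stub_torusOfCara` asks: for `c ≥ 0`, `c 1 = 0`, with `L_c` absolutely convergent on `re s > 1` and
ONE holomorphic `F` on `re s > 1/2`, `F = L_c − 1/(s−1)` on `re s > 1`,
`Re F(s) ≤ 1/2 + Re(1/s) + ½Re ψ(s/2) − ½log π` — prove the torus inequality
`Σ_{A⊆S} (c−Λ)(n_A) n_A^{-1/2} 2^{-|A|} cos(|A|φ) ≤ 1/2`.  This file and its sequel prove it for weights that
are EVENTUALLY VON MANGOLDT (`c n = Λ n` for `n ≥ N`), the class of all finitely supported modifications of `Λ`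
(the disprover's `SlackBall`, `Negative/SlackBall.lean`), where `P(s) := Σ_{n<N} (c−Λ)(n) n^{-s}` is a
Dirichlet POLYNOMIAL.  Here (part I):

* `re_logDeriv_riemannXi_half_add` — `Re ξ'/ξ(1/2 + it) = 0` for every real `t` (functional equation
  `ξ'/ξ(1−s) = −ξ'/ξ(s)` and Schwarz reflection `ξ'/ξ(s̄) = conj ξ'/ξ(s)`, both in the tree; no hypothesis on
  zeros: at a zero both sides are the junk value `0`).
* `dirichletPoly_re_le_half_add_re_logDeriv_riemannXi` — on `re s > 1/2`, `ζ₁(s) ≠ 0`: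
  `Re P(s) ≤ 1/2 + Re ξ'/ξ(s)`.  The majorant is hypothesised for the abstract continuation `F`; the identity
  theorem on the (convex) half-plane applied to the HOLOMORPHIC combination `Ψ = (F − P)·ζ₁ + ζ₁'` (which vanishes
  on `re s > 1` by `L_c = L_Λ + P`, `ζ₁'/ζ₁ = 1/(s−1) − L_Λ`) identifies `F = P − ζ₁'/ζ₁` wherever `ζ₁ ≠ 0`, and
  `1/s + Γ_ℝ'/Γ_ℝ + ζ₁'/ζ₁ = ξ'/ξ` (`logDeriv_riemannXi_eq`, `logDeriv_Gammaℝ`).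
* `re_dirichletPoly_critical_le_half` — hence `Re P(1/2 + it) ≤ 1/2` for EVERY real `t`: at non-zeros of `ξ`
  let `σ ↓ 1/2` (continuity of `ξ'/ξ` and of `P`); the zeros of `ξ` on the line are isolated (`ξ(0) = 1/2`), so
  the remaining `t` are limits of good ones (continuity of `P`).

Part II (`…TorusFinite.lean`) takes Bohr means of `(1/2 − Re P(1/2+it)) · Π_{p∈S}(1 + cos(t log p + φ)) ≥ 0`.
-/

noncomputable section

-- `Summit.RiemannHypothesis.RiemannHypothesis.…` repeats a namespace component by design (D-0017 layout).
set_option linter.dupNamespace false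

open scoped BigOperators ComplexConjugate Topology
open Complex Filter Set

namespace Summit.RiemannHypothesis.RiemannHypothesis.Theorems.SignConeConeMagnification

open Literature.NumberTheory.LFunctions ArithmeticFunction

/-! ## `Re ξ'/ξ = 0` on the critical line -/

/-- **`Re ξ'/ξ(1/2 + it) = 0`** for every real `t`: `s̄ = 1 − s` on the critical line, so
`conj (ξ'/ξ(s)) = ξ'/ξ(s̄) = ξ'/ξ(1 − s) = −ξ'/ξ(s)` (`logDeriv_riemannXi_conj`, `logDeriv_riemannXi_one_sub`).
Unconditional and hypothesis-free (at a zero of `ξ` both sides are the junk value `0`). [folklore] -/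
theorem re_logDeriv_riemannXi_half_add (t : ℝ) :
    (logDeriv riemannXi (1 / 2 + t * I)).re = 0 := by
  set s : ℂ := 1 / 2 + t * I with hs
  have hconj : conj s = 1 - s := by
    apply Complex.ext
    · simp [hs]; norm_num
    · simp [hs]
  have h1 := logDeriv_riemannXi_conj s
  rw [hconj, logDeriv_riemannXi_one_sub] at h1
  have h2 := congrArg Complex.re h1
  simp only [neg_re, Complex.conj_re] at h2
  linarith

/-! ## The Dirichlet polynomial `P(s) = Σ_{1 ≤ n < N} (c − Λ)(n) n^{-s}` of an eventually-`Λ` weight -/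

/-- For `c = Λ` off `{n < N}`, the L-series of `c − Λ` IS the Dirichlet polynomial
`Σ_{1 ≤ n < N} (c − Λ)(n) n^{-s}` (every `s`). [folklore] -/
theorem lseries_sub_vonMangoldt_eq_sum {c : ℕ → ℝ} {N : ℕ} (hN : ∀ n, N ≤ n → c n = Λ n) (s : ℂ) :
    LSeries (fun n => ((c n - Λ n : ℝ) : ℂ)) s =
      ∑ n ∈ Finset.Ico 1 N, ((c n - Λ n : ℝ) : ℂ) / (n : ℂ) ^ s := by
  unfold LSeries
  refine (tsum_eq_sum (s := Finset.Ico 1 N) fun n hn => ?_).trans (Finset.sum_congr rfl fun n hn => ?_)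
  · rw [Finset.mem_Ico, not_and_or, not_le, not_lt] at hn
    rcases hn with h0 | hN'
    · have : n = 0 := by omega
      simp [this, LSeries.term]
    · simp [LSeries.term, hN n hN']
  · rw [Finset.mem_Ico] at hn
    rw [LSeries.term_of_ne_zero (by omega)]

/-- The L-series of `c − Λ` (eventually zero) converges absolutely everywhere. [folklore] -/
theorem lseriesSummable_sub_vonMangoldt {c : ℕ → ℝ} {N : ℕ} (hN : ∀ n, N ≤ n → c n = Λ n) (s : ℂ) :
    LSeriesSummable (fun n => ((c n - Λ n : ℝ) : ℂ)) s := by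
  refine summable_of_ne_finset_zero (s := Finset.Ico 1 N) fun n hn => ?_
  rw [Finset.mem_Ico, not_and_or, not_le, not_lt] at hn
  rcases hn with h0 | hN'
  · have : n = 0 := by omega
    simp [this, LSeries.term]
  · simp [LSeries.term, hN n hN']

/-- A Dirichlet polynomial `Σ_{1 ≤ n < N} a(n) n^{-s}` is entire. [folklore] -/
theorem differentiable_dirichletPoly (a : ℕ → ℂ) (N : ℕ) :
    Differentiable ℂ fun s : ℂ => ∑ n ∈ Finset.Ico 1 N, a n / (n : ℂ) ^ s := by
  refine Differentiable.fun_sum fun n hn => ?_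
  have hn0 : (n : ℂ) ≠ 0 := by
    rw [Finset.mem_Ico] at hn
    exact_mod_cast (show n ≠ 0 by omega)
  refine (differentiable_const _).div (fun s => differentiableAt_id.const_cpow (Or.inl hn0)) fun s => ?_
  rw [Ne, cpow_eq_zero_iff]
  exact fun h => hn0 h.1

/-- **From the Carathéodory majorant of an abstract continuation to `Re P ≤ 1/2 + Re ξ'/ξ`.**  Let `c = Λ`
off `{n < N}`, `L_c` absolutely convergent on `re s > 1`, and `F` holomorphic on `re s > 1/2` with
`F = L_c − 1/(s−1)` on `re s > 1` and `Re F ≤ 1/2 + Re(1/s) + ½Re ψ(s/2) − ½log π` on `re s > 1/2`.  Then at every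
`s` with `re s > 1/2`, `ζ₁(s) ≠ 0`: `Re P(s) ≤ 1/2 + Re ξ'/ξ(s)` for the Dirichlet polynomial `P` of `c − Λ`.
Proof: `Ψ := (F − P)·ζ₁ + ζ₁'` is holomorphic on the half-plane and `0` on `re s > 1`
(`L_c = L_Λ + P`, `ζ₁'/ζ₁ = 1/(s−1) − L_Λ`), hence `0` (identity theorem on a convex set); so
`P = F + ζ₁'/ζ₁` where `ζ₁ ≠ 0`, and `1/s + Γ_ℝ'/Γ_ℝ + ζ₁'/ζ₁ = ξ'/ξ`, `Γ_ℝ'/Γ_ℝ = −½log π + ½ψ(s/2)`. [folklore] -/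
theorem dirichletPoly_re_le_half_add_re_logDeriv_riemannXi {c : ℕ → ℝ} {N : ℕ}
    (hN : ∀ n, N ≤ n → c n = Λ n)
    (hsum : ∀ σ : ℝ, 1 < σ → LSeriesSummable (fun n => ((c n : ℝ) : ℂ)) σ)
    {F : ℂ → ℂ} (hF : DifferentiableOn ℂ F {s : ℂ | 1 / 2 < s.re})
    (hFeq : ∀ s : ℂ, 1 < s.re → F s = LSeries (fun n => ((c n : ℝ) : ℂ)) s - 1 / (s - 1))
    (hcara : ∀ s : ℂ, 1 / 2 < s.re →
      (F s).re ≤ 1 / 2 + (1 / s).re + (Complex.digamma (s / 2)).re / 2 - Real.log Real.pi / 2)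
    {s : ℂ} (hs : 1 / 2 < s.re) (hζ : riemannZeta₁ s ≠ 0) :
    (∑ n ∈ Finset.Ico 1 N, ((c n - Λ n : ℝ) : ℂ) / (n : ℂ) ^ s).re ≤
      1 / 2 + (logDeriv riemannXi s).re := by
  set P : ℂ → ℂ := fun z => ∑ n ∈ Finset.Ico 1 N, ((c n - Λ n : ℝ) : ℂ) / (n : ℂ) ^ z with hP
  have hPd : Differentiable ℂ P := differentiable_dirichletPoly _ N
  -- `L_c` converges absolutely at every `z` with `re z > 1` (compare with the real point `re z`)
  have hsumz : ∀ z : ℂ, 1 < z.re → LSeriesSummable (fun n => ((c n : ℝ) : ℂ)) z := fun z hz =>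
    (LSeriesSummable_iff_of_re_eq_re (show (z.re : ℂ).re = z.re by simp)).mp (hsum z.re hz)
  -- on `re z > 1`: `F = P − ζ₁'/ζ₁`
  have hright : ∀ z : ℂ, 1 < z.re → F z = P z - logDeriv riemannZeta₁ z := by
    intro z hz
    have hc : (fun n => ((c n : ℝ) : ℂ)) = (fun n => ((Λ n : ℝ) : ℂ)) + fun n => ((c n - Λ n : ℝ) : ℂ) := by
      ext n
      simp only [Pi.add_apply]
      push_cast
      ring
    have hL : LSeries (fun n => ((c n : ℝ) : ℂ)) z =
        LSeries (fun n => ((Λ n : ℝ) : ℂ)) z + P z := by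
      rw [hc, LSeries_add (ArithmeticFunction.LSeriesSummable_vonMangoldt hz)
        (lseriesSummable_sub_vonMangoldt hN z), lseries_sub_vonMangoldt_eq_sum hN z]
    rw [hFeq z hz, hL]
    have hζ₁ := logDeriv_riemannZeta₁_eq_of_one_lt_re hz
    -- `hζ₁ : logDeriv ζ₁ z = 1/(z-1) - L ↗Λ z`
    rw [hζ₁]
    ring
  -- the holomorphic combination `Ψ = (F − P)·ζ₁ + ζ₁'` vanishes identically on the half-plane
  set Ψ : ℂ → ℂ := fun z => (F z - P z) * riemannZeta₁ z + deriv riemannZeta₁ z with hΨ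
  have hopen : IsOpen {z : ℂ | 1 / 2 < z.re} := isOpen_lt continuous_const Complex.continuous_re
  have hΨa : AnalyticOnNhd ℂ Ψ {z : ℂ | 1 / 2 < z.re} := by
    have hFa : AnalyticOnNhd ℂ F {z : ℂ | 1 / 2 < z.re} :=
      (Complex.analyticOnNhd_iff_differentiableOn hopen).mpr hF
    have hPa : AnalyticOnNhd ℂ P {z : ℂ | 1 / 2 < z.re} :=
      (Complex.analyticOnNhd_univ_iff_differentiable.mpr hPd).mono (subset_univ _)
    have hζa : AnalyticOnNhd ℂ riemannZeta₁ {z : ℂ | 1 / 2 < z.re} :=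
      (Complex.analyticOnNhd_univ_iff_differentiable.mpr differentiable_riemannZeta₁).mono (subset_univ _)
    have hdζa : AnalyticOnNhd ℂ (deriv riemannZeta₁) {z : ℂ | 1 / 2 < z.re} :=
      (Complex.analyticOnNhd_univ_iff_differentiable.mpr differentiable_riemannZeta₁.deriv).mono
        (subset_univ _)
    exact ((hFa.sub hPa).mul hζa).add hdζa
  have hΨ2 : Ψ =ᶠ[𝓝 (2 : ℂ)] 0 := by
    have hmem : {z : ℂ | 1 < z.re} ∈ 𝓝 (2 : ℂ) :=
      (isOpen_lt continuous_const Complex.continuous_re).mem_nhds (by simp)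
    filter_upwards [hmem] with z hz
    have hz' : 1 < z.re := hz
    have hζz : riemannZeta₁ z ≠ 0 := (riemannZeta₁_ne_zero_of_riemannXi hz'.le).2
    simp only [hΨ, Pi.zero_apply, hright z hz', logDeriv_apply]
    field_simp
    ring
  have hΨ0 : EqOn Ψ 0 {z : ℂ | 1 / 2 < z.re} :=
    hΨa.eqOn_zero_of_preconnected_of_eventuallyEq_zero (convex_halfSpace_re_gt (1 / 2)).isPreconnected
      (z₀ := 2) (by simp; norm_num) hΨ2
  -- at `s`: `P s = F s + ζ₁'/ζ₁(s)`
  have hPs : P s = F s + logDeriv riemannZeta₁ s := by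
    have h0 : (F s - P s) * riemannZeta₁ s + deriv riemannZeta₁ s = 0 := hΨ0 hs
    rw [logDeriv_apply]
    field_simp
    linear_combination -h0
  -- the majorant, rewritten through `ξ'/ξ = 1/s + Γ_ℝ'/Γ_ℝ + ζ₁'/ζ₁`
  have hs0 : 0 < s.re := by linarith
  have hxi : logDeriv riemannXi s = 1 / s + logDeriv Gammaℝ s + logDeriv riemannZeta₁ s :=
    logDeriv_riemannXi_eq hs0 hζ
  have hG : logDeriv Gammaℝ s = -(Complex.log Real.pi) / 2 + Complex.digamma (s / 2) / 2 :=
    Literature.NumberTheory.LFunctions.logDeriv_Gammaℝ (half_ne_neg_nat_of_re_pos' hs0)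
  have hre : (logDeriv riemannXi s).re =
      (1 / s).re - Real.log Real.pi / 2 + (Complex.digamma (s / 2)).re / 2 + (logDeriv riemannZeta₁ s).re := by
    rw [hxi, hG, ← Complex.ofReal_log Real.pi_pos.le]
    simp only [add_re, neg_re, div_ofNat_re, Complex.ofReal_re, neg_div]
    ring
  have hmaj := hcara s hs
  have hPre : (P s).re = (F s).re + (logDeriv riemannZeta₁ s).re := by rw [hPs, add_re]
  show (P s).re ≤ 1 / 2 + (logDeriv riemannXi s).re
  rw [hPre, hre]
  linarith

/-- **`Re P(1/2 + it) ≤ 1/2` for every real `t`** (the boundary form of the Carathéodory majorant for an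
eventually-`Λ` weight).  At a `t` with `ξ(1/2+it) ≠ 0` (so `ζ₁ ≠ 0` nearby) let `σ ↓ 1/2` in
`dirichletPoly_re_le_half_add_re_logDeriv_riemannXi` (`ξ'/ξ` is continuous there and `Re ξ'/ξ(1/2+it) = 0`);
the zeros of `ξ` are isolated (`ξ ≢ 0`: `ξ(0) = 1/2`), so every other `t` is a limit of such, and `P` is
continuous.  This is the registered sub-goal of the eventually-`Λ` case of `stub_torusOfCara`. [folklore] -/
theorem re_dirichletPoly_critical_le_half :
    ∀ c : ℕ → ℝ, ∀ N : ℕ, (∀ n, N ≤ n → c n = ArithmeticFunction.vonMangoldt n) →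
      (∀ σ : ℝ, 1 < σ → LSeriesSummable (fun n => ((c n : ℝ) : ℂ)) σ) →
      (∃ F : ℂ → ℂ, DifferentiableOn ℂ F {s : ℂ | 1 / 2 < s.re} ∧
        (∀ s : ℂ, 1 < s.re → F s = LSeries (fun n => ((c n : ℝ) : ℂ)) s - 1 / (s - 1)) ∧
        ∀ s : ℂ, 1 / 2 < s.re →
          (F s).re ≤ 1 / 2 + (1 / s).re + (Complex.digamma (s / 2)).re / 2 - Real.log Real.pi / 2) →
      ∀ t : ℝ, (∑ n ∈ Finset.Ico 1 N, ((c n - ArithmeticFunction.vonMangoldt n : ℝ) : ℂ) /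
        (n : ℂ) ^ ((1 / 2 : ℂ) + t * I)).re ≤ 1 / 2 := by
  intro c N hN hsum hF t
  obtain ⟨F, hFd, hFeq, hcara⟩ := hF
  set P : ℂ → ℂ := fun z => ∑ n ∈ Finset.Ico 1 N, ((c n - Λ n : ℝ) : ℂ) / (n : ℂ) ^ z with hP
  have hPc : Continuous P := (differentiable_dirichletPoly _ N).continuous
  -- the inequality at the non-zeros of `ξ` on the line
  have hkey : ∀ u : ℝ, riemannXi (1 / 2 + u * I) ≠ 0 → (P (1 / 2 + u * I)).re ≤ 1 / 2 := by
    intro u hu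
    set s₀ : ℂ := 1 / 2 + u * I with hs₀
    have hre₀ : s₀.re = 1 / 2 := by simp [hs₀]
    have hζ₀ : riemannZeta₁ s₀ ≠ 0 := (riemannXi_ne_zero_iff_of_re_pos (by rw [hre₀]; norm_num)).mp hu
    set g : ℝ → ℝ := fun ε => 1 / 2 + (logDeriv riemannXi (s₀ + ε)).re - (P (s₀ + ε)).re with hg
    -- `g ≥ 0` just to the right of `s₀`
    have hev : ∀ᶠ ε in 𝓝[>] (0 : ℝ), 0 ≤ g ε := by
      have hcont : ContinuousAt (fun ε : ℝ => riemannZeta₁ (s₀ + ε)) 0 :=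
        (differentiable_riemannZeta₁.continuous.comp (continuous_const.add Complex.continuous_ofReal)).continuousAt
      have hne : ∀ᶠ ε : ℝ in 𝓝 0, riemannZeta₁ (s₀ + (ε : ℂ)) ≠ 0 :=
        hcont.eventually_ne (by simpa using hζ₀)
      filter_upwards [nhdsWithin_le_nhds hne, self_mem_nhdsWithin] with ε hε hpos
      have hpos' : (0 : ℝ) < ε := hpos
      have hsε : 1 / 2 < (s₀ + ε).re := by simp [hs₀]; linarith
      have := dirichletPoly_re_le_half_add_re_logDeriv_riemannXi hN hsum hFd hFeq hcara hsε hε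
      simp only [hg]
      linarith
    -- `g` is continuous at `0` (`ξ(s₀) ≠ 0`)
    have hgc : ContinuousAt g 0 := by
      have hpath : Continuous fun ε : ℝ => s₀ + (ε : ℂ) := continuous_const.add Complex.continuous_ofReal
      have hld : ContinuousAt (logDeriv riemannXi) s₀ := by
        have : logDeriv riemannXi = fun z => deriv riemannXi z / riemannXi z := by
          ext z; rw [logDeriv_apply]
        rw [this]
        exact continuous_deriv_riemannXi.continuousAt.div
          differentiable_riemannXi.continuous.continuousAt hu
      have h1 : ContinuousAt (fun ε : ℝ => logDeriv riemannXi (s₀ + ε)) 0 := by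
        have h0 : s₀ + ((0 : ℝ) : ℂ) = s₀ := by simp
        exact ContinuousAt.comp (by rw [h0]; exact hld) hpath.continuousAt
      have h2 : ContinuousAt (fun ε : ℝ => P (s₀ + ε)) 0 := (hPc.comp hpath).continuousAt
      simp only [hg]
      exact ((continuousAt_const.add (Complex.continuous_re.continuousAt.comp h1)).sub
        (Complex.continuous_re.continuousAt.comp h2))
    have h0 : 0 ≤ g 0 := ge_of_tendsto (hgc.tendsto.mono_left nhdsWithin_le_nhds) hev
    have h0' : 0 ≤ 1 / 2 + (logDeriv riemannXi (s₀ + ((0 : ℝ) : ℂ))).re - (P (s₀ + ((0 : ℝ) : ℂ))).re := h0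
    simp only [Complex.ofReal_zero, add_zero] at h0'
    have hxi0 : (logDeriv riemannXi s₀).re = 0 := re_logDeriv_riemannXi_half_add u
    linarith
  by_cases hξ : riemannXi (1 / 2 + t * I) = 0
  · -- `t` is the ordinate of a zero: approach along the line through non-zeros
    set s₀ : ℂ := 1 / 2 + t * I with hs₀
    have han : AnalyticAt ℂ riemannXi s₀ := differentiable_riemannXi.analyticAt s₀
    rcases han.eventually_eq_zero_or_eventually_ne_zero with h0 | hne
    · exfalso
      have hall : EqOn riemannXi 0 univ :=
        (Complex.analyticOnNhd_univ_iff_differentiable.mpr differentiable_riemannXi)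
          |>.eqOn_zero_of_preconnected_of_eventuallyEq_zero isPreconnected_univ (mem_univ s₀) h0
      have := hall (mem_univ (0 : ℂ))
      rw [Pi.zero_apply, riemannXi_zero] at this
      norm_num at this
    · set γ : ℝ → ℂ := fun δ => s₀ + (δ : ℂ) * I with hγ
      have hγc : Continuous γ := continuous_const.add (Complex.continuous_ofReal.mul continuous_const)
      have hγ0 : γ 0 = s₀ := by simp [hγ]
      have hγt : Tendsto γ (𝓝[>] 0) (𝓝[≠] s₀) := by
        refine tendsto_nhdsWithin_iff.mpr ⟨?_, ?_⟩
        · rw [← hγ0]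
          exact hγc.continuousAt.tendsto.mono_left nhdsWithin_le_nhds
        · filter_upwards [self_mem_nhdsWithin] with δ hδ
          have hδ' : (0 : ℝ) < δ := hδ
          simp only [hγ, mem_compl_iff, mem_singleton_iff, add_eq_left, mul_eq_zero, Complex.ofReal_eq_zero,
            I_ne_zero, or_false]
          exact hδ'.ne'
      have hev : ∀ᶠ δ in 𝓝[>] (0 : ℝ), (P (γ δ)).re ≤ 1 / 2 := by
        filter_upwards [hγt.eventually hne] with δ hδ
        have hform : γ δ = 1 / 2 + ((t + δ : ℝ) : ℂ) * I := by
          simp only [hγ, hs₀]; push_cast; ring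
        rw [hform] at hδ ⊢
        exact hkey (t + δ) hδ
      have hlim : Tendsto (fun δ : ℝ => (P (γ δ)).re) (𝓝[>] 0) (𝓝 ((P s₀).re)) := by
        rw [← hγ0]
        exact ((Complex.continuous_re.comp (hPc.comp hγc)).continuousAt.tendsto).mono_left nhdsWithin_le_nhds
      exact le_of_tendsto hlim hev
  · exact hkey t hξ

end Summit.RiemannHypothesis.RiemannHypothesis.Theorems.SignConeConeMagnification

end
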